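import Summits.QuantumFields.BalabanUV.T4Continuum.Spine.NE2.CovariantTableTower

/-!
# T⁴ programme, spine node NE2 (U1a) — R14 W2, file 2: THE TWO-LEVEL PAIRING LAW OF A TABLE TOWER WITH A POSITION-DEPENDENT CONSISTENCY WEIGHT
# `‖√((Ln)^d)·(Q′(T′) − Q′⊗1)(J_L ⊗ 1) − √(n^d)·(Q(T) − Q⊗1)‖ ≤ card o·(θ + τ/n)` from a consistency weight `ϑ(r_μ, t′)` of MEAN `≤ θ` and the size `τ`
# (cell `pub-balaban-gaps`, seat ne2 gen 4; plan `run/shared/lean/pub/pub-balaban-gaps/ne/NE2-R14-PLAN.md` W2)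

W1's `CovariantTablePairingLaw.opNorm_pairing_leT` / `CovariantTableTower.averagingLaws_EcovT` read the two-level consistency of a table tower in SUP form
`hT2 : ∀ y μ j r t′, ‖T′_{y,L·j+r,μ,t′} − T_{y,j,μ,⌊(r_μ+t′)/L⌋}‖ ≤ θ`.  For BAŁABAN's COMPOSED table (`CovariantTableBalaban.TBal`) the sup form is the WRONG currency: the
level-`(k+1)` chain of the fine pair `(L·j + r, t′)` and the level-`k` chain of its geometric parent `(j, ⌊(r_μ + t′)/L⌋)` part ways at the CARRY `r_μ + t′ mod L ≥ L`, from the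
level `k − v` on, `v = v_L(⌊t′/L⌋ + 1)` the depth of the carry cascade — so the entry difference is `O(a_{k−v})` (sizes at the coarsest affected level), small only ON AVERAGE over
the line position `t′` (a fraction `L^{−v}` of the positions has depth `≥ v`).  The Schur test behind the pairing law needs only ROW and COLUMN sums, i.e. only the MEAN of the
consistency weight over `(r_μ, t′)`.  THIS FILE re-runs W1 file 3 §1–§3 and file 4 §4 with a WEIGHT `ϑ : ℕ → ℕ → ℝ` in place of the constant `θ`:
`hT2 : ‖T′_{y,L·j+r,μ,t′} − T_{y,j,μ,⌊(r_μ+t′)/L⌋}‖ ≤ ϑ(r_μ, t′)` and `hϑ : Σ_{ρ<L} Σ_{t′<Ln} ϑ(ρ, t′) ≤ θ·L·(Ln)` (mean `≤ θ`) — SAME conclusions `card o·(θ + τ/n)`: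
`norm_pairing_apply_le_mean`, `pairing_row_le_mean`, `pairing_col_le_mean`, `opNorm_pairDT_le_mean`, **`opNorm_pairing_le_mean`**, and the tower packaging
`opNorm_EcovT_succ_mul_J_sub_le_mean`, **`averagingLaws_EcovT_mean`** (defect `Cst·card o·(θ_k + τ·L^{−k})`), **`averagingLaws_EcovT_mean_rate`** (`θ_k ≤ θ₀ρ^k`, `L⁻¹ ≤ ρ`
⟹ defect `(Cst·card o·(θ₀ + τ))·ρ^k`, the shape `CovariantTableTower.perturbationLaws_avgPertT_rate` consumes).  File 3 of W2 supplies `ϑ` and its mean for `TBal`.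
HONEST FRAMING (T4-DAG p. 1).  Bookkeeping (Schur bounds) about TYPED operators; `T`, `ϑ`, `θ`, `τ` DATA/hypotheses asserted by nobody; nothing of [B7] (124)/(15) constructed
(DIVERGENCE F6 (ζ)); NOT NE2, NOT [B9] (3.16)/(3.26) as printed; NE2 (U1a) NOT PROVED; spine PROVED 0/9 unchanged; NOT continuum YM / infinite volume / mass gap / Clay.  HONEST
DEPENDENCY: continuum YM on T⁴ ⇐ BetaPertH ∧ nine spine estimates (0/9 proved); BetaPertH ⇐ (D1) ∧ (D4) ∧ CAP+tail; G-an2-4 gates asym, D1 and NE2/3/4.  No `sorry`, no `def`.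
-/

noncomputable section

open scoped BigOperators ComplexConjugate Matrix Matrix.Norms.L2Operator Kronecker
open Finset

namespace Summit.QuantumFields.BalabanUV.T4Continuum.NE2.CovariantTablePairingMean

open Literature.MathematicalPhysics.QuantumFieldTheory.Balaban1983to89.B5Prop11Plancherel (Tor fine unitVec Cst Cst_nonneg)
open Literature.MathematicalPhysics.QuantumFieldTheory.Balaban1983to89.B5Block118 (QvOp bpt tstep tstep_zero)
open Literature.MathematicalPhysics.QuantumFieldTheory.Balaban1983to89.B5G183RateUnitTower (lev lev_neZero)
open Summit.QuantumFields.BalabanUV.T4Continuum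
open Summit.QuantumFields.BalabanUV.T4Continuum.BalabanAveragedTowerUnit (idx norm_entry_le_opNorm one_le_lev' cast_lev')
open Summit.QuantumFields.BalabanUV.T4Continuum.BalabanAveragedTowerModes (par)
open Summit.QuantumFields.BalabanUV.T4Continuum.KingPairingPlantedLaw (JK JpcT calDalev calDalev_inv opNorm_inv_calDalev_le sqrt_facts)
open Summit.QuantumFields.BalabanUV.T4Continuum.BlockPairingGeometry (parT JK_apply)
open Summit.QuantumFields.BalabanUV.T4Continuum.LineAveragingPairing (glue sum_glue par_bpt_glue_add_tstep tent_count sum_fun_coord cL norm_cL_le)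
open Summit.QuantumFields.BalabanUV.T4Continuum.KroneckerLift
open Summit.QuantumFields.BalabanUV.T4Continuum.CovariantBlockAveraging (mul_JK_kron_apply sqrt_mul_consts sum_fun_coord' tent_transport opNorm_le_sqrt_of_schur
  sum_blocks_ite' averagingLaws_mono)
open Summit.QuantumFields.BalabanUV.T4Continuum.NE2.CovariantTableAveraging (Table QcovT QcovT_sub_kron_apply opNorm_QcovT_sub_kron_le)
open Summit.QuantumFields.BalabanUV.T4Continuum.NE2.CovariantTablePairing (pairDT pairing_applyT)
open Summit.QuantumFields.BalabanUV.T4Continuum.NE2.CovariantTableTower (QcovLevT EcovT opNorm_EcovT_le)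
open Summit.QuantumFields.BalabanUV.T4Continuum.GramPerturbationLaw (AveragingLaws)

variable {d : ℕ}

section TwoLevel

variable (n L : ℕ) [NeZero n] [NeZero L] (M : Fin d → ℕ) [hM : ∀ μ, NeZero (M μ)] {o : Type*} [Fintype o] [DecidableEq o]

omit [NeZero n] hM in
/-- sums over offset vectors of a REAL function of one coordinate: `Σ_r φ(r_μ) = L^{d−1}·Σ_ρ φ(ρ)` (`CovariantBlockAveraging.sum_fun_coord'` over `ℝ`). [folklore] -/
theorem sum_fun_coord_real (μ : Fin d) (φ : Fin L → ℝ) :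
    ∑ r : Fin d → Fin L, φ (r μ) = (L : ℝ) ^ (d - 1) * ∑ ρ : Fin L, φ ρ := by
  have h := sum_fun_coord' (d := d) L μ (fun ρ => (φ ρ : ℂ))
  exact_mod_cast h

/-- **ENTRY LAW WITH A CONSISTENCY WEIGHT**: with `‖T′_{y,L·j+r,μ,t′} − T_{y,j,μ,⌊(r_μ+t′)/L⌋}‖ ≤ ϑ(r_μ, t′)` and the size `τ`,
`|pairing entry| ≤ n^{−(d+1)}·(L^{−(d+1)}·Σ 𝟙·ϑ + (τ/2)·(G_n + G_0))`. [folklore] -/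
theorem norm_pairing_apply_le_mean {T' : Table d (L * n) M o} {T : Table d n M o} {ϑ : ℕ → ℕ → ℝ} {τ : ℝ}
    (hT2 : ∀ (y : Tor M) (μ : Fin d) (j : Fin d → Fin n) (r : Fin d → Fin L) (t' : ℕ), t' < L * n →
      ‖T' y (glue n L (j, r)) μ t' - T y j μ (((r μ : ℕ) + t') / L)‖ ≤ ϑ (r μ) t')
    (hTτ : ∀ (y : Tor M) (μ : Fin d) (j : Fin d → Fin n) (s : ℕ), s ≤ n → ‖T y j μ s - 1‖ ≤ τ)
    (b : (Tor M × Fin d) × o) (i : Tor (fine n M) × Fin d) (α' : o) :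
    ‖pairDT n L M T' T b (i, α')‖
      ≤ if i.2 = b.1.2 then
          (1 / (n : ℝ) ^ (d + 1)) *
            ((1 / (L : ℝ) ^ (d + 1)) *
                ∑ j : Fin d → Fin n, ∑ r : Fin d → Fin L, ∑ t' : Fin (L * n),
                  (if bpt n M b.1.1 j + tstep (fine n M) b.1.2 (((r b.1.2 : ℕ) + t') / L) = i.1 then ϑ (r b.1.2) t' else 0)
              + (τ / 2) * (∑ j : Fin d → Fin n, (if bpt n M b.1.1 j + tstep (fine n M) b.1.2 n = i.1 then (1 : ℝ) else 0)
                  + ∑ j : Fin d → Fin n, (if bpt n M b.1.1 j + tstep (fine n M) b.1.2 0 = i.1 then (1 : ℝ) else 0)))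
        else 0 := by
  have hL : 0 < L := Nat.pos_of_ne_zero (NeZero.ne L)
  rw [pairing_applyT]
  by_cases h : i.2 = b.1.2
  · rw [if_pos h, if_pos h, norm_mul, norm_div, norm_one, norm_pow, Complex.norm_natCast]
    refine mul_le_mul_of_nonneg_left ?_ (by positivity)
    refine (norm_add_le _ _).trans (add_le_add ?_ ?_)
    · rw [norm_mul, norm_div, norm_one, norm_pow, Complex.norm_natCast]
      refine mul_le_mul_of_nonneg_left ?_ (by positivity)
      refine (norm_sum_le _ _).trans (Finset.sum_le_sum fun j _ => ?_)
      refine (norm_sum_le _ _).trans (Finset.sum_le_sum fun r _ => ?_)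
      refine (norm_sum_le _ _).trans (Finset.sum_le_sum fun t' _ => ?_)
      split_ifs
      · exact (norm_entry_le_opNorm _ _ _).trans (hT2 _ _ _ _ _ t'.isLt)
      · simp
    · rw [norm_mul]
      have hA : ∀ j : Fin d → Fin n,
          ‖(if bpt n M b.1.1 j + tstep (fine n M) b.1.2 n = i.1 then (T b.1.1 j b.1.2 n - 1) b.2 α' else 0)
              - (if bpt n M b.1.1 j + tstep (fine n M) b.1.2 0 = i.1 then (T b.1.1 j b.1.2 0 - 1) b.2 α' else 0)‖
            ≤ τ * (if bpt n M b.1.1 j + tstep (fine n M) b.1.2 n = i.1 then (1 : ℝ) else 0)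
              + τ * (if bpt n M b.1.1 j + tstep (fine n M) b.1.2 0 = i.1 then (1 : ℝ) else 0) := by
        intro j
        refine (norm_sub_le _ _).trans (add_le_add ?_ ?_)
        · split_ifs
          · rw [mul_one]; exact (norm_entry_le_opNorm _ _ _).trans (hTτ _ _ _ _ le_rfl)
          · simp
        · split_ifs
          · rw [mul_one]; exact (norm_entry_le_opNorm _ _ _).trans (hTτ _ _ _ _ (Nat.zero_le _))
          · simp
      calc _ ≤ (1 / 2) * ∑ j : Fin d → Fin n,
              (τ * (if bpt n M b.1.1 j + tstep (fine n M) b.1.2 n = i.1 then (1 : ℝ) else 0)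
                + τ * (if bpt n M b.1.1 j + tstep (fine n M) b.1.2 0 = i.1 then (1 : ℝ) else 0)) :=
            mul_le_mul (norm_cL_le L hL) ((norm_sum_le _ _).trans (Finset.sum_le_sum fun j _ => hA j)) (norm_nonneg _)
              (by norm_num)
        _ = _ := by rw [Finset.sum_add_distrib, ← Finset.mul_sum, ← Finset.mul_sum]; ring
  · rw [if_neg h, if_neg h, norm_zero]

/-- **ROW SUMS** of the two-level pairing matrix under a consistency weight of mean `≤ θ`: `≤ card o·(θ + τ/n)`. [folklore] -/
theorem pairing_row_le_mean {T' : Table d (L * n) M o} {T : Table d n M o} {ϑ : ℕ → ℕ → ℝ} {θ τ : ℝ}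
    (hT2 : ∀ (y : Tor M) (μ : Fin d) (j : Fin d → Fin n) (r : Fin d → Fin L) (t' : ℕ), t' < L * n →
      ‖T' y (glue n L (j, r)) μ t' - T y j μ (((r μ : ℕ) + t') / L)‖ ≤ ϑ (r μ) t')
    (hϑ : ∑ ρ : Fin L, ∑ t' : Fin (L * n), ϑ ρ t' ≤ θ * (L * (L * n)))
    (hTτ : ∀ (y : Tor M) (μ : Fin d) (j : Fin d → Fin n) (s : ℕ), s ≤ n → ‖T y j μ s - 1‖ ≤ τ)
    (b : (Tor M × Fin d) × o) :
    ∑ c : (Tor (fine n M) × Fin d) × o, ‖pairDT n L M T' T b c‖ ≤ Fintype.card o * (θ + τ / n) := by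
  have hn : (n : ℝ) ≠ 0 := by exact_mod_cast NeZero.ne n
  have hLr : (L : ℝ) ≠ 0 := by exact_mod_cast NeZero.ne L
  have hLpos : (0 : ℝ) < L := by exact_mod_cast Nat.pos_of_ne_zero (NeZero.ne L)
  have hnpos : (0 : ℝ) < n := by exact_mod_cast Nat.pos_of_ne_zero (NeZero.ne n)
  -- the weighted chain count: `Σ_x Σ_{j,r,t′} 𝟙[…= x]·ϑ = n^d·L^{d−1}·Σ_{ρ,t′} ϑ ≤ n^d·L^d·(L n)·θ`
  have hN : ∑ x : Tor (fine n M), ∑ j : Fin d → Fin n, ∑ r : Fin d → Fin L, ∑ t' : Fin (L * n),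
      (if bpt n M b.1.1 j + tstep (fine n M) b.1.2 (((r b.1.2 : ℕ) + t') / L) = x then ϑ (r b.1.2) t' else 0)
      ≤ (n : ℝ) ^ d * ((L : ℝ) ^ d * (L * n)) * θ := by
    rw [Finset.sum_comm]
    have e : ∀ j : Fin d → Fin n, ∑ x : Tor (fine n M), ∑ r : Fin d → Fin L, ∑ t' : Fin (L * n),
        (if bpt n M b.1.1 j + tstep (fine n M) b.1.2 (((r b.1.2 : ℕ) + t') / L) = x then ϑ (r b.1.2) t' else 0)
        = (L : ℝ) ^ (d - 1) * ∑ ρ : Fin L, ∑ t' : Fin (L * n), ϑ ρ t' := by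
      intro j
      rw [Finset.sum_comm]
      have e2 : ∀ r : Fin d → Fin L, ∑ x : Tor (fine n M), ∑ t' : Fin (L * n),
          (if bpt n M b.1.1 j + tstep (fine n M) b.1.2 (((r b.1.2 : ℕ) + t') / L) = x then ϑ (r b.1.2) t' else 0)
            = ∑ t' : Fin (L * n), ϑ (r b.1.2) t' := by
        intro r
        rw [Finset.sum_comm]
        simp only [Finset.sum_ite_eq, Finset.mem_univ, if_true]
      rw [Finset.sum_congr rfl fun r _ => e2 r]
      exact sum_fun_coord_real L b.1.2 (fun ρ => ∑ t' : Fin (L * n), ϑ ρ t')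
    rw [Finset.sum_congr rfl fun j _ => e j, Finset.sum_const, Finset.card_univ]
    simp only [Fintype.card_fun, Fintype.card_fin, nsmul_eq_mul]
    have hd1 : (L : ℝ) ^ d = L * (L : ℝ) ^ (d - 1) := by
      rcases Nat.eq_zero_or_pos d with hd | hd
      · subst hd; exact (Fin.elim0 b.1.2 : False).elim |> False.elim
      · rw [← pow_succ']; congr 1; omega
    push_cast
    rw [hd1]
    calc (n : ℝ) ^ d * ((L : ℝ) ^ (d - 1) * ∑ ρ : Fin L, ∑ t' : Fin (L * n), ϑ ρ t')
        ≤ (n : ℝ) ^ d * ((L : ℝ) ^ (d - 1) * (θ * (L * (L * n)))) := by gcongr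
      _ = (n : ℝ) ^ d * (L * (L : ℝ) ^ (d - 1) * (L * n)) * θ := by ring
  have hG : ∀ s : ℕ, ∑ x : Tor (fine n M), ∑ j : Fin d → Fin n, (if bpt n M b.1.1 j + tstep (fine n M) b.1.2 s = x then (1 : ℝ) else 0)
      = (n : ℝ) ^ d := by
    intro s
    rw [Finset.sum_comm]
    simp only [Finset.sum_ite_eq, Finset.mem_univ, if_true, Finset.sum_const, Finset.card_univ, Fintype.card_fun, Fintype.card_fin,
      nsmul_eq_mul, mul_one]
    push_cast; ring
  rw [Fintype.sum_prod_type]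
  calc ∑ i : Tor (fine n M) × Fin d, ∑ α' : o, ‖pairDT n L M T' T b (i, α')‖
      ≤ ∑ i : Tor (fine n M) × Fin d, ∑ _α' : o, (if i.2 = b.1.2 then
          (1 / (n : ℝ) ^ (d + 1)) *
            ((1 / (L : ℝ) ^ (d + 1)) *
                ∑ j : Fin d → Fin n, ∑ r : Fin d → Fin L, ∑ t' : Fin (L * n),
                  (if bpt n M b.1.1 j + tstep (fine n M) b.1.2 (((r b.1.2 : ℕ) + t') / L) = i.1 then ϑ (r b.1.2) t' else 0)
              + (τ / 2) * (∑ j : Fin d → Fin n, (if bpt n M b.1.1 j + tstep (fine n M) b.1.2 n = i.1 then (1 : ℝ) else 0)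
                  + ∑ j : Fin d → Fin n, (if bpt n M b.1.1 j + tstep (fine n M) b.1.2 0 = i.1 then (1 : ℝ) else 0)))
          else 0) :=
        Finset.sum_le_sum fun i _ => Finset.sum_le_sum fun α' _ => norm_pairing_apply_le_mean n L M hT2 hTτ b i α'
    _ = Fintype.card o * ((1 / (n : ℝ) ^ (d + 1)) * ((1 / (L : ℝ) ^ (d + 1)) *
          (∑ x : Tor (fine n M), ∑ j : Fin d → Fin n, ∑ r : Fin d → Fin L, ∑ t' : Fin (L * n),
            (if bpt n M b.1.1 j + tstep (fine n M) b.1.2 (((r b.1.2 : ℕ) + t') / L) = x then ϑ (r b.1.2) t' else 0))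
          + (τ / 2) * ((n : ℝ) ^ d + (n : ℝ) ^ d))) := by
        simp only [Finset.sum_const, Finset.card_univ, nsmul_eq_mul]
        rw [← Finset.mul_sum, Fintype.sum_prod_type]
        simp only [Finset.sum_ite_eq', Finset.mem_univ, if_true]
        rw [← Finset.mul_sum, Finset.sum_add_distrib, ← Finset.mul_sum, ← Finset.mul_sum, Finset.sum_add_distrib, hG, hG]
    _ ≤ Fintype.card o * ((1 / (n : ℝ) ^ (d + 1)) * ((1 / (L : ℝ) ^ (d + 1)) * ((n : ℝ) ^ d * ((L : ℝ) ^ d * (L * n)) * θ)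
          + (τ / 2) * ((n : ℝ) ^ d + (n : ℝ) ^ d))) := by gcongr
    _ = Fintype.card o * (θ + τ / n) := by
        field_simp
        ring

/-- **COLUMN SUMS** of the two-level pairing matrix under a consistency weight of mean `≤ θ`: `≤ card o·(θ + τ/n)·n^{−d}`. [folklore] -/
theorem pairing_col_le_mean {T' : Table d (L * n) M o} {T : Table d n M o} {ϑ : ℕ → ℕ → ℝ} {θ τ : ℝ}
    (hT2 : ∀ (y : Tor M) (μ : Fin d) (j : Fin d → Fin n) (r : Fin d → Fin L) (t' : ℕ), t' < L * n →
      ‖T' y (glue n L (j, r)) μ t' - T y j μ (((r μ : ℕ) + t') / L)‖ ≤ ϑ (r μ) t')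
    (hϑ : ∑ ρ : Fin L, ∑ t' : Fin (L * n), ϑ ρ t' ≤ θ * (L * (L * n)))
    (hTτ : ∀ (y : Tor M) (μ : Fin d) (j : Fin d → Fin n) (s : ℕ), s ≤ n → ‖T y j μ s - 1‖ ≤ τ)
    (i : Tor (fine n M) × Fin d) (α' : o) :
    ∑ b : (Tor M × Fin d) × o, ‖pairDT n L M T' T b (i, α')‖ ≤ Fintype.card o * (θ + τ / n) * (1 / (n : ℝ) ^ d) := by
  have hn : (n : ℝ) ≠ 0 := by exact_mod_cast NeZero.ne n
  have hLr : (L : ℝ) ≠ 0 := by exact_mod_cast NeZero.ne L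
  have hN : ∑ y : Tor M, ∑ j : Fin d → Fin n, ∑ r : Fin d → Fin L, ∑ t' : Fin (L * n),
      (if bpt n M y j + tstep (fine n M) i.2 (((r i.2 : ℕ) + t') / L) = i.1 then ϑ (r i.2) t' else 0)
      ≤ (L : ℝ) ^ d * (L * n) * θ := by
    have e : ∀ y : Tor M, ∑ j : Fin d → Fin n, ∑ r : Fin d → Fin L, ∑ t' : Fin (L * n),
        (if bpt n M y j + tstep (fine n M) i.2 (((r i.2 : ℕ) + t') / L) = i.1 then ϑ (r i.2) t' else 0)
        = ∑ r : Fin d → Fin L, ∑ t' : Fin (L * n), ∑ j : Fin d → Fin n,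
          (if bpt n M y j + tstep (fine n M) i.2 (((r i.2 : ℕ) + t') / L) = i.1 then ϑ (r i.2) t' else 0) := by
      intro y
      rw [Finset.sum_comm]
      exact Finset.sum_congr rfl fun r _ => Finset.sum_comm
    rw [Finset.sum_congr rfl fun y _ => e y, Finset.sum_comm]
    have e2 : ∀ r : Fin d → Fin L, ∑ y : Tor M, ∑ t' : Fin (L * n), ∑ j : Fin d → Fin n,
        (if bpt n M y j + tstep (fine n M) i.2 (((r i.2 : ℕ) + t') / L) = i.1 then ϑ (r i.2) t' else 0)
          = ∑ t' : Fin (L * n), ϑ (r i.2) t' := by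
      intro r
      rw [Finset.sum_comm]
      refine Finset.sum_congr rfl fun t' _ => ?_
      exact sum_blocks_ite' n M i.1 _ _
    rw [Finset.sum_congr rfl fun r _ => e2 r, sum_fun_coord_real L i.2 (fun ρ => ∑ t' : Fin (L * n), ϑ ρ t')]
    have hd1 : (L : ℝ) ^ d = L * (L : ℝ) ^ (d - 1) := by
      rcases Nat.eq_zero_or_pos d with hd | hd
      · subst hd; exact (Fin.elim0 i.2 : False).elim |> False.elim
      · rw [← pow_succ']; congr 1; omega
    rw [hd1]
    calc (L : ℝ) ^ (d - 1) * ∑ ρ : Fin L, ∑ t' : Fin (L * n), ϑ ρ t'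
        ≤ (L : ℝ) ^ (d - 1) * (θ * (L * (L * n))) := by gcongr
      _ = L * (L : ℝ) ^ (d - 1) * (L * n) * θ := by ring
  rw [Fintype.sum_prod_type]
  calc ∑ b1 : Tor M × Fin d, ∑ α : o, ‖pairDT n L M T' T (b1, α) (i, α')‖
      ≤ ∑ b1 : Tor M × Fin d, ∑ _α : o, (if i.2 = b1.2 then
          (1 / (n : ℝ) ^ (d + 1)) *
            ((1 / (L : ℝ) ^ (d + 1)) *
                ∑ j : Fin d → Fin n, ∑ r : Fin d → Fin L, ∑ t' : Fin (L * n),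
                  (if bpt n M b1.1 j + tstep (fine n M) b1.2 (((r b1.2 : ℕ) + t') / L) = i.1 then ϑ (r b1.2) t' else 0)
              + (τ / 2) * (∑ j : Fin d → Fin n, (if bpt n M b1.1 j + tstep (fine n M) b1.2 n = i.1 then (1 : ℝ) else 0)
                  + ∑ j : Fin d → Fin n, (if bpt n M b1.1 j + tstep (fine n M) b1.2 0 = i.1 then (1 : ℝ) else 0)))
          else 0) :=
        Finset.sum_le_sum fun b1 _ => Finset.sum_le_sum fun α _ => norm_pairing_apply_le_mean n L M hT2 hTτ (b1, α) i α'
    _ = Fintype.card o * ((1 / (n : ℝ) ^ (d + 1)) * ((1 / (L : ℝ) ^ (d + 1)) *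
          (∑ y : Tor M, ∑ j : Fin d → Fin n, ∑ r : Fin d → Fin L, ∑ t' : Fin (L * n),
            (if bpt n M y j + tstep (fine n M) i.2 (((r i.2 : ℕ) + t') / L) = i.1 then ϑ (r i.2) t' else 0))
          + (τ / 2) * ((1 : ℝ) + 1))) := by
        simp only [Finset.sum_const, Finset.card_univ, nsmul_eq_mul]
        rw [← Finset.mul_sum, Fintype.sum_prod_type]
        simp only [Finset.sum_ite_eq, Finset.mem_univ, if_true]
        rw [← Finset.mul_sum, Finset.sum_add_distrib, ← Finset.mul_sum, ← Finset.mul_sum, Finset.sum_add_distrib,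
          sum_blocks_ite', sum_blocks_ite']
    _ ≤ Fintype.card o * ((1 / (n : ℝ) ^ (d + 1)) * ((1 / (L : ℝ) ^ (d + 1)) * ((L : ℝ) ^ d * (L * n) * θ)
          + (τ / 2) * ((1 : ℝ) + 1))) := by gcongr
    _ = Fintype.card o * (θ + τ / n) * (1 / (n : ℝ) ^ d) := by
        field_simp
        ring

/-- **THE TWO-LEVEL PAIRING BOUND (Schur) UNDER A CONSISTENCY WEIGHT OF MEAN `≤ θ`**: `‖D‖ ≤ card o·(θ + τ/n)·(√(n^d))⁻¹`. [folklore] -/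
theorem opNorm_pairDT_le_mean {T' : Table d (L * n) M o} {T : Table d n M o} {ϑ : ℕ → ℕ → ℝ} {θ τ : ℝ} (hθ : 0 ≤ θ) (hτ : 0 ≤ τ)
    (hT2 : ∀ (y : Tor M) (μ : Fin d) (j : Fin d → Fin n) (r : Fin d → Fin L) (t' : ℕ), t' < L * n →
      ‖T' y (glue n L (j, r)) μ t' - T y j μ (((r μ : ℕ) + t') / L)‖ ≤ ϑ (r μ) t')
    (hϑ : ∑ ρ : Fin L, ∑ t' : Fin (L * n), ϑ ρ t' ≤ θ * (L * (L * n)))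
    (hTτ : ∀ (y : Tor M) (μ : Fin d) (j : Fin d → Fin n) (s : ℕ), s ≤ n → ‖T y j μ s - 1‖ ≤ τ) :
    ‖pairDT n L M T' T‖ ≤ Fintype.card o * (θ + τ / n) * (Real.sqrt ((n : ℝ) ^ d))⁻¹ := by
  have hn : (0 : ℝ) < (n : ℝ) ^ d := pow_pos (by exact_mod_cast Nat.pos_of_ne_zero (NeZero.ne n)) d
  have hK : 0 ≤ (Fintype.card o : ℝ) * (θ + τ / n) := by positivity
  refine (opNorm_le_sqrt_of_schur (R := Fintype.card o * (θ + τ / n)) (C := Fintype.card o * (θ + τ / n) * (1 / (n : ℝ) ^ d)) _ hK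
    (by positivity) (pairing_row_le_mean n L M hT2 hϑ hTτ)
    (fun c => by obtain ⟨i, α'⟩ := c; exact pairing_col_le_mean n L M hT2 hϑ hTτ i α')).trans (le_of_eq ?_)
  rw [show (Fintype.card o : ℝ) * (θ + τ / n) * (Fintype.card o * (θ + τ / n) * (1 / (n : ℝ) ^ d))
      = (Fintype.card o * (θ + τ / n)) ^ 2 * ((n : ℝ) ^ d)⁻¹ by ring,
    Real.sqrt_mul (sq_nonneg _), Real.sqrt_sq hK, Real.sqrt_inv]

/-- **THE TWO-LEVEL PAIRING OF THE SCALED TRANSPORT ERRORS UNDER A CONSISTENCY WEIGHT OF MEAN `≤ θ`**: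
`‖√((Ln)^d)·(Q′(T′) − Q′ ⊗ 1)(J_L ⊗ 1) − √(n^d)·(Q(T) − Q ⊗ 1)‖ ≤ card o·(θ + τ/n)`. [folklore] -/
theorem opNorm_pairing_le_mean {T' : Table d (L * n) M o} {T : Table d n M o} {ϑ : ℕ → ℕ → ℝ} {θ τ : ℝ} (hθ : 0 ≤ θ) (hτ : 0 ≤ τ)
    (hT2 : ∀ (y : Tor M) (μ : Fin d) (j : Fin d → Fin n) (r : Fin d → Fin L) (t' : ℕ), t' < L * n →
      ‖T' y (glue n L (j, r)) μ t' - T y j μ (((r μ : ℕ) + t') / L)‖ ≤ ϑ (r μ) t')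
    (hϑ : ∑ ρ : Fin L, ∑ t' : Fin (L * n), ϑ ρ t' ≤ θ * (L * (L * n)))
    (hTτ : ∀ (y : Tor M) (μ : Fin d) (j : Fin d → Fin n) (s : ℕ), s ≤ n → ‖T y j μ s - 1‖ ≤ τ) :
    ‖(((Real.sqrt ((((L * n : ℕ)) : ℝ) ^ d)) : ℝ) : ℂ)
        • ((QcovT (L * n) M T' - QvOp (L * n) M ⊗ₖ (1 : Matrix o o ℂ)) * (JK n L M ⊗ₖ (1 : Matrix o o ℂ)))
      - (((Real.sqrt ((n : ℝ) ^ d)) : ℝ) : ℂ) • (QcovT n M T - QvOp n M ⊗ₖ (1 : Matrix o o ℂ))‖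
      ≤ Fintype.card o * (θ + τ / n) := by
  have hn0 : (0 : ℝ) ≤ (n : ℝ) ^ d := pow_nonneg (Nat.cast_nonneg _) d
  have hpos : 0 < Real.sqrt ((n : ℝ) ^ d) := Real.sqrt_pos.mpr (pow_pos (by exact_mod_cast Nat.pos_of_ne_zero (NeZero.ne n)) d)
  have hsq : Real.sqrt ((((L * n : ℕ)) : ℝ) ^ d) = Real.sqrt ((n : ℝ) ^ d) * Real.sqrt ((L : ℝ) ^ d) := by
    rw [← Real.sqrt_mul hn0]; congr 1; push_cast; ring
  have e : (((Real.sqrt ((((L * n : ℕ)) : ℝ) ^ d)) : ℝ) : ℂ)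
        • ((QcovT (L * n) M T' - QvOp (L * n) M ⊗ₖ (1 : Matrix o o ℂ)) * (JK n L M ⊗ₖ (1 : Matrix o o ℂ)))
      - (((Real.sqrt ((n : ℝ) ^ d)) : ℝ) : ℂ) • (QcovT n M T - QvOp n M ⊗ₖ (1 : Matrix o o ℂ))
      = (((Real.sqrt ((n : ℝ) ^ d)) : ℝ) : ℂ) • pairDT n L M T' T := by
    conv_rhs => rw [pairDT, smul_sub, smul_smul, ← Complex.ofReal_mul, ← hsq]
  rw [e, norm_smul, Complex.norm_real, Real.norm_of_nonneg hpos.le]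
  calc Real.sqrt ((n : ℝ) ^ d) * ‖pairDT n L M T' T‖
      ≤ Real.sqrt ((n : ℝ) ^ d) * (Fintype.card o * (θ + τ / n) * (Real.sqrt ((n : ℝ) ^ d))⁻¹) :=
        mul_le_mul_of_nonneg_left (opNorm_pairDT_le_mean n L M hθ hτ hT2 hϑ hTτ) hpos.le
    _ = Fintype.card o * (θ + τ / n) := by field_simp

end TwoLevel

/-! ## Tower packaging: the `E`-datum of the Gram law from a consistency weight of mean `θ_k` -/

section Tower

variable (L : ℕ) [NeZero L] (M : Fin d → ℕ) [hM : ∀ μ, NeZero (M μ)] {o : Type*} [Fintype o] [DecidableEq o]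

/-- **THE SANDWICH-FREE TWO-LEVEL LAW OF `E_k(T)` UNDER A CONSISTENCY WEIGHT**: `‖E_{k+1}(J_k ⊗ 1) − E_k‖ ≤ card o·(θ_k + τ·L^{−k})` from
`‖T_{k+1}(y,L·j+r,μ,t′) − T_k(y,j,μ,⌊(r_μ+t′)/L⌋)‖ ≤ ϑ_k(r_μ, t′)` with `Σ_{ρ<L}Σ_{t′<L·n_k} ϑ_k(ρ,t′) ≤ θ_k·L·(L·n_k)`. [folklore] -/
theorem opNorm_EcovT_succ_mul_J_sub_le_mean {T : (k : ℕ) → Table d (lev L k) M o} {ϑ : ℕ → ℕ → ℕ → ℝ} {θ : ℕ → ℝ} {τ : ℝ}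
    (hθ : ∀ k, 0 ≤ θ k) (hτ : 0 ≤ τ)
    (hT2 : ∀ (k : ℕ) (y : Tor M) (μ : Fin d) (j : Fin d → Fin (lev L k)) (r : Fin d → Fin L) (t' : ℕ), t' < L * lev L k →
      ‖T (k + 1) y (glue (lev L k) L (j, r)) μ t' - T k y j μ (((r μ : ℕ) + t') / L)‖ ≤ ϑ k (r μ) t')
    (hϑ : ∀ k, ∑ ρ : Fin L, ∑ t' : Fin (L * lev L k), ϑ k ρ t' ≤ θ k * (L * (L * lev L k)))
    (hTτ : ∀ (k : ℕ) (y : Tor M) (μ : Fin d) (j : Fin d → Fin (lev L k)) (s : ℕ), s ≤ lev L k → ‖T k y j μ s - 1‖ ≤ τ) (k : ℕ) :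
    ‖EcovT L M T (k + 1) * (JpcT L M k ⊗ₖ (1 : Matrix o o ℂ)) - EcovT L M T k‖ ≤ Fintype.card o * (θ k + τ / (lev L k : ℕ)) := by
  have h := opNorm_pairing_le_mean (lev L k) L M (hθ k) hτ (hT2 k) (hϑ k) (hTτ k)
  rw [EcovT, EcovT, Matrix.smul_mul]
  exact h

variable (a : ℝ) (ha : 0 < a)

/-- **THE `E`-DATUM OF THE GRAM LAW FOR A TABLE TOWER FROM A CONSISTENCY WEIGHT OF MEAN `θ_k` AND THE SIZE `τ`**:
`AveragingLaws (D ⊗ 1) (E(T)) (J ⊗ 1) (card o·τ) (k ↦ Cst·card o·(θ_k + τ·L^{−k}))` — W1's `averagingLaws_EcovT` with the sup-consistency replaced by its mean over the line.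
[cite: Balaban1984PropagatorsI, Prop. 1.1 (1.89) p.33 (‖Δ_a⁻¹‖ ≤ Cst)] [folklore] -/
theorem averagingLaws_EcovT_mean {T : (k : ℕ) → Table d (lev L k) M o} {ϑ : ℕ → ℕ → ℕ → ℝ} {θ : ℕ → ℝ} {τ : ℝ}
    (hθ : ∀ k, 0 ≤ θ k) (hτ : 0 ≤ τ)
    (hT2 : ∀ (k : ℕ) (y : Tor M) (μ : Fin d) (j : Fin d → Fin (lev L k)) (r : Fin d → Fin L) (t' : ℕ), t' < L * lev L k →
      ‖T (k + 1) y (glue (lev L k) L (j, r)) μ t' - T k y j μ (((r μ : ℕ) + t') / L)‖ ≤ ϑ k (r μ) t')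
    (hϑ : ∀ k, ∑ ρ : Fin L, ∑ t' : Fin (L * lev L k), ϑ k ρ t' ≤ θ k * (L * (L * lev L k)))
    (hTτ : ∀ (k : ℕ) (y : Tor M) (μ : Fin d) (j : Fin d → Fin (lev L k)) (s : ℕ), s ≤ lev L k → ‖T k y j μ s - 1‖ ≤ τ) :
    AveragingLaws (fun k => calDalev L M a ha k ⊗ₖ (1 : Matrix o o ℂ)) (EcovT L M T) (fun k => JpcT L M k ⊗ₖ (1 : Matrix o o ℂ))
      (Fintype.card o * τ) (fun k => Cst d a * (Fintype.card o * (θ k + τ / (lev L k : ℕ)))) where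
  opNorm_le := fun k => opNorm_EcovT_le L M hτ (fun k y j μ t => hTτ k y μ j t (le_of_lt t.isLt)) k
  pair_mul_inv_le := fun k => by
    have hG : ‖(calDalev L M a ha k ⊗ₖ (1 : Matrix o o ℂ))⁻¹‖ ≤ Cst d a := by
      rw [kron_inv]; exact (opNorm_kron_le o _).trans (opNorm_inv_calDalev_le L M a ha k)
    calc _ ≤ ‖EcovT L M T (k + 1) * (JpcT L M k ⊗ₖ (1 : Matrix o o ℂ)) - EcovT L M T k‖ * ‖(calDalev L M a ha k ⊗ₖ (1 : Matrix o o ℂ))⁻¹‖ :=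
          Matrix.l2_opNorm_mul _ _
      _ ≤ Fintype.card o * (θ k + τ / (lev L k : ℕ)) * Cst d a :=
          mul_le_mul (opNorm_EcovT_succ_mul_J_sub_le_mean L M hθ hτ hT2 hϑ hTτ k) hG (norm_nonneg _)
            (mul_nonneg (Nat.cast_nonneg _) (add_nonneg (hθ k) (div_nonneg hτ (Nat.cast_nonneg _))))
      _ = _ := by ring
  inv_mul_pair_le := fun k => by
    have hG : ‖(calDalev L M a ha k ⊗ₖ (1 : Matrix o o ℂ))⁻¹‖ ≤ Cst d a := by
      rw [kron_inv]; exact (opNorm_kron_le o _).trans (opNorm_inv_calDalev_le L M a ha k)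
    have hH : ((calDalev L M a ha k ⊗ₖ (1 : Matrix o o ℂ))⁻¹)ᴴ = (calDalev L M a ha k ⊗ₖ (1 : Matrix o o ℂ))⁻¹ := by
      rw [kron_inv, kron_conjTranspose, calDalev_inv]
      congr 1
      exact (Literature.MathematicalPhysics.QuantumFieldTheory.Balaban1983to89.B5Prop11Plancherel.calG_isHermitian (lev L k)
        (one_le_lev' L k) M a ha).eq
    rw [← Matrix.l2_opNorm_conjTranspose, Matrix.conjTranspose_mul, Matrix.conjTranspose_conjTranspose, hH]
    calc _ ≤ ‖EcovT L M T (k + 1) * (JpcT L M k ⊗ₖ (1 : Matrix o o ℂ)) - EcovT L M T k‖ * ‖(calDalev L M a ha k ⊗ₖ (1 : Matrix o o ℂ))⁻¹‖ :=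
          Matrix.l2_opNorm_mul _ _
      _ ≤ Fintype.card o * (θ k + τ / (lev L k : ℕ)) * Cst d a :=
          mul_le_mul (opNorm_EcovT_succ_mul_J_sub_le_mean L M hθ hτ hT2 hϑ hTτ k) hG (norm_nonneg _)
            (mul_nonneg (Nat.cast_nonneg _) (add_nonneg (hθ k) (div_nonneg hτ (Nat.cast_nonneg _))))
      _ = _ := by ring

/-- **GEOMETRIC FORM AT A RATE `ρ ∈ [L⁻¹, 1)`** (the shape `CovariantTableTower.perturbationLaws_avgPertT_rate` consumes): mean consistency `θ_k ≤ θ₀·ρ^k` ⟹ pairing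
sequence `(Cst·card o·(θ₀ + τ))·ρ^k` (the size term `τ·L^{−k} ≤ τ·ρ^k`). [folklore] -/
theorem averagingLaws_EcovT_mean_rate {T : (k : ℕ) → Table d (lev L k) M o} {ϑ : ℕ → ℕ → ℕ → ℝ} {θ : ℕ → ℝ} {τ θ₀ ρ : ℝ}
    (hθ : ∀ k, 0 ≤ θ k) (hτ : 0 ≤ τ) (hρ : ((L : ℝ)⁻¹) ≤ ρ) (hθg : ∀ k, θ k ≤ θ₀ * ρ ^ k)
    (hT2 : ∀ (k : ℕ) (y : Tor M) (μ : Fin d) (j : Fin d → Fin (lev L k)) (r : Fin d → Fin L) (t' : ℕ), t' < L * lev L k →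
      ‖T (k + 1) y (glue (lev L k) L (j, r)) μ t' - T k y j μ (((r μ : ℕ) + t') / L)‖ ≤ ϑ k (r μ) t')
    (hϑ : ∀ k, ∑ ρ : Fin L, ∑ t' : Fin (L * lev L k), ϑ k ρ t' ≤ θ k * (L * (L * lev L k)))
    (hTτ : ∀ (k : ℕ) (y : Tor M) (μ : Fin d) (j : Fin d → Fin (lev L k)) (s : ℕ), s ≤ lev L k → ‖T k y j μ s - 1‖ ≤ τ) :
    AveragingLaws (fun k => calDalev L M a ha k ⊗ₖ (1 : Matrix o o ℂ)) (EcovT L M T) (fun k => JpcT L M k ⊗ₖ (1 : Matrix o o ℂ))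
      (Fintype.card o * τ) (fun k => (Cst d a * Fintype.card o * (θ₀ + τ)) * ρ ^ k) := by
  refine averagingLaws_mono (averagingLaws_EcovT_mean L M a ha hθ hτ hT2 hϑ hTτ) fun k => ?_
  have hlev : (τ / (lev L k : ℕ) : ℝ) = τ * ((L : ℝ)⁻¹) ^ k := by rw [cast_lev', inv_pow, div_eq_mul_inv]
  rw [hlev]
  have hC := Cst_nonneg d a
  have hL0 : (0 : ℝ) ≤ (L : ℝ)⁻¹ := inv_nonneg.mpr (Nat.cast_nonneg L)
  have hpow : ((L : ℝ)⁻¹) ^ k ≤ ρ ^ k := pow_le_pow_left₀ hL0 hρ k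
  have hρk : 0 ≤ ρ ^ k := pow_nonneg (hL0.trans hρ) k
  calc Cst d a * (Fintype.card o * (θ k + τ * ((L : ℝ)⁻¹) ^ k))
      ≤ Cst d a * (Fintype.card o * (θ₀ * ρ ^ k + τ * ρ ^ k)) := by gcongr; exact hθg k
    _ = (Cst d a * Fintype.card o * (θ₀ + τ)) * ρ ^ k := by ring

end Tower

end Summit.QuantumFields.BalabanUV.T4Continuum.NE2.CovariantTablePairingMean

end
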